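import Mathlib.Algebra.Order.Round
import Mathlib.LinearAlgebra.LinearIndependent.Lemmas
import Mathlib.Data.Int.Order.Lemmas
import Literature.Algebra.EuclideanLattices.SuccessiveMinimaLeIff
import HarnessLib

/-!
# Short vectors of a lattice with a gap are multiples of the shortest vector (Regev 2004, Claim 3.13)

Topic `Algebra/EuclideanLattices` (family `pqc`). Proved material (no named fact) towards the
named fact `Literature.Algebra.EuclideanLattices.usvp_of_dihedralCoset` (O. Regev, *Quantum
computation and lattice problems*, SIAM J. Comput. 33 (2004), Thm. 1.1): the two lattice-theoretic
ingredients of Regev's Claims 3.5 / 3.13 ("there is at most one element of the form `(0, ā)` and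
at most one of the form `(1, ā')` mapped to the measured value; if both, `ā' - ā` is the hidden
difference"), isolated from the quantum routine:

* `exists_int_smul_of_norm_lt_successiveMinimum_two` — in a discrete `ℤ`-submodule `L` of a
  real normed space whose real span has dimension `≥ 2`, every lattice vector of norm `< λ₂(L)` is
  an *integer* multiple of any shortest nonzero vector `ū` (Regev, proof of Claim 3.5, p. 9: "If
  `v̄' - v̄` is not a multiple of the shortest vector, then `‖v̄' - v̄‖ > c_unq n^{1+2f} ‖ū‖`", i.e.
  the contrapositive of the unique-SVP promise `λ₂ ≥ γ λ₁`; standard, cf. Lyubashevsky–Micciancio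
  2009, §3);
* `Regev2004.int_modEq_of_sub_eq_smul` — **the `mod p` bookkeeping of Claims 3.5 / 3.13**
  (pp. 9, 15): for Regev's map `f(t, ā) = (a_{i₀} p + t m) b_{i₀} + ∑_{i ≠ i₀} aᵢ bᵢ` on a linearly
  independent family `b`, if `f(t', ā') - f(t, ā) = k ū` with `ū = ∑ uᵢ bᵢ`, `u_{i₀} ≡ m (mod p)`
  and `p ∤ m` (`p` prime), then `k ≡ t' - t (mod p)`; with the two elementary consequences used
  there, `Regev2004.eq_zero_of_modEq_zero_of_abs_lt` (`t = t'`, `|k| < p` forces `k = 0`) and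
  `Regev2004.eq_one_of_modEq_one_of_abs_lt` (`t = 0`, `t' = 1`, `|k| < p - 1` forces `k = 1`).

## References

* O. Regev, *Quantum computation and lattice problems*, SIAM J. Comput. 33 (2004), Claims 3.5,
  3.13 (pp. 8–9, 14–15).
* C. Peikert, *A decade of lattice cryptography* (2016), §2.2.1 (successive minima).
-/

noncomputable section

open Module Metric

namespace Literature.Algebra.EuclideanLattices

section Lattice

variable {E : Type*} [NormedAddCommGroup E] [NormedSpace ℝ E]

/-- **Vectors shorter than `λ₂` are integer multiples of the shortest vector.** Let `L` be a
discrete `ℤ`-submodule of a real normed space with `rk_ℝ (span ℝ L) ≥ 2` (so that `λ₂(L)` is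
not the junk value), let `ū ∈ L` be a shortest nonzero vector (`‖ū‖ = λ₁(L)`), and let `w ∈ L`
with `‖w‖ < λ₂(L)`. Then `w = k ū` for some `k ∈ ℤ`: otherwise `ū, w` are `ℝ`-independent
lattice vectors in the closed ball of radius `max(‖ū‖, ‖w‖) = ‖w‖`, forcing `λ₂(L) ≤ ‖w‖`
(`successiveMinimum_le_iff`); and a real multiple `c ū ∈ L` has `c ∈ ℤ` since
`‖(c - round c) ū‖ ≤ ½ ‖ū‖ < λ₁(L)`. This is the lattice half of Regev's Claims 3.5 / 3.13.
[cite: Regev2004, Claim 3.5 (proof, p. 9) and Claim 3.13 (proof, pp. 14–15)] -/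
theorem exists_int_smul_of_norm_lt_successiveMinimum_two (L : Submodule ℤ E) [DiscreteTopology L]
    (h2 : 2 ≤ finrank ℝ (Submodule.span ℝ (L : Set E)))
    {u : E} (hu : u ∈ L) (hu0 : u ≠ 0) (hmin : ‖u‖ = minNorm L)
    {w : E} (hw : w ∈ L) (hlt : ‖w‖ < successiveMinimum L 2) :
    ∃ k : ℤ, w = k • u := by
  have hle_norm : ∀ {x : E}, x ∈ L → x ≠ 0 → minNorm L ≤ ‖x‖ := fun hx hx0 =>
    csInf_le ⟨0, by rintro _ ⟨y, -, rfl⟩; exact norm_nonneg y⟩ ⟨_, ⟨hx, hx0⟩, rfl⟩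
  -- Step 1: `w` is a real multiple of `u`
  obtain ⟨c, hc⟩ : ∃ c : ℝ, c • u = w := by
    by_contra hne
    push Not at hne
    have hli : LinearIndependent ℝ ![u, w] := (LinearIndependent.pair_iff' hu0).2 hne
    have hw0 : w ≠ 0 := by
      have := hli.ne_zero 1
      simpa using this
    have hle : successiveMinimum L 2 ≤ max ‖u‖ ‖w‖ := by
      refine (successiveMinimum_le_iff_holds L h2 (le_max_of_le_left (norm_nonneg _))).2
        ⟨![u, w], hli, fun k => ?_⟩
      fin_cases k
      · exact ⟨by simpa using hu, by simp⟩
      · exact ⟨by simpa using hw, by simp⟩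
    have hmax : max ‖u‖ ‖w‖ = ‖w‖ := max_eq_right (by rw [hmin]; exact hle_norm hw hw0)
    rw [hmax] at hle
    exact absurd hlt (not_lt.2 hle)
  -- Step 2: the real coefficient is an integer
  refine ⟨round c, ?_⟩
  by_contra hne
  have hmem : w - (round c : ℤ) • u ∈ L := L.sub_mem hw (L.smul_mem _ hu)
  have hne' : w - (round c : ℤ) • u ≠ 0 := sub_ne_zero.2 hne
  have h1 : minNorm L ≤ ‖w - (round c : ℤ) • u‖ := hle_norm hmem hne'
  have h2' : ‖w - (round c : ℤ) • u‖ ≤ 1 / 2 * ‖u‖ := by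
    rw [← hc, ← Int.cast_smul_eq_zsmul ℝ (round c) u, ← sub_smul, norm_smul, Real.norm_eq_abs]
    exact mul_le_mul_of_nonneg_right (abs_sub_round c) (norm_nonneg _)
  have hpos : 0 < ‖u‖ := norm_pos_iff.2 hu0
  rw [← hmin] at h1
  linarith

end Lattice

section ModP

variable {E : Type*} [AddCommGroup E] [Module ℝ E] {n : ℕ}

/-- **Regev 2004, the `mod p` bookkeeping of Claims 3.5 / 3.13.** Let `b₀, …, bₙ₋₁` be
`ℝ`-linearly independent, `ū = ∑ uᵢ bᵢ` with `u ∈ ℤⁿ`, `p` a prime not dividing `m`, and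
`u_{i₀} ≡ m (mod p)`. Regev's map sends `(t, ā) ∈ ℤ × ℤⁿ` to the lattice point with coefficient
vector `ā` except `a_{i₀} p + t m` at `i₀` (`Function.update a i₀ (a i₀ * p + t * m)`). If
`f(t', ā') - f(t, ā) = k ū` for an integer `k`, then `k ≡ t' - t (mod p)` — "by considering the
first coordinate of `v̄' - v̄` in the lattice basis we get `(a'₁ p + t' m) - (a₁ p + t m) ≡ k·m`,
this implies `k ≡ t' - t (mod p)`" (pp. 9, 15; there `i₀ = 1`).
[cite: Regev2004, Claim 3.5 (proof, p. 9) and Claim 3.13 (proof, p. 15)] -/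
theorem Regev2004.int_modEq_of_sub_eq_smul {b : Fin n → E} (hb : LinearIndependent ℝ b)
    {p : ℕ} (hp : p.Prime) {m : ℤ} (hm : ¬ (p : ℤ) ∣ m) {u : Fin n → ℤ} {i₀ : Fin n}
    (hu : u i₀ ≡ m [ZMOD p]) {t t' : ℤ} {a a' : Fin n → ℤ} {k : ℤ}
    (h : ∑ i, ((Function.update a' i₀ (a' i₀ * p + t' * m) i : ℤ) : ℝ) • b i -
        ∑ i, ((Function.update a i₀ (a i₀ * p + t * m) i : ℤ) : ℝ) • b i =
        (k : ℝ) • ∑ i, ((u i : ℤ) : ℝ) • b i) :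
    k ≡ t' - t [ZMOD p] := by
  -- compare the coefficients at `i₀` (uniqueness of coordinates in the independent family `b`)
  set c' : Fin n → ℤ := Function.update a' i₀ (a' i₀ * p + t' * m) with hc'
  set c : Fin n → ℤ := Function.update a i₀ (a i₀ * p + t * m) with hc
  have hzero : ∑ i, ((c' i - c i - k * u i : ℤ) : ℝ) • b i = 0 := by
    have : ∑ i, ((c' i - c i - k * u i : ℤ) : ℝ) • b i =
        (∑ i, ((c' i : ℤ) : ℝ) • b i - ∑ i, ((c i : ℤ) : ℝ) • b i) -
          (k : ℝ) • ∑ i, ((u i : ℤ) : ℝ) • b i := by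
      simp only [Int.cast_sub, Int.cast_mul, sub_smul, mul_smul, Finset.sum_sub_distrib,
        Finset.smul_sum]
    rw [this, h, sub_self]
  have hcoef := (Fintype.linearIndependent_iff.1 hb) _ hzero i₀
  have hint : c' i₀ - c i₀ - k * u i₀ = 0 := by exact_mod_cast hcoef
  have hi₀ : c' i₀ - c i₀ = (a' i₀ - a i₀) * p + (t' - t) * m := by
    simp only [hc', hc, Function.update_self]
    ring
  -- `(t' - t) m ≡ k u_{i₀} ≡ k m (mod p)`, and `m` is invertible modulo the prime `p`
  have hmod : (t' - t) * m ≡ k * m [ZMOD p] := by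
    have e1 : (t' - t) * m = k * u i₀ - (a' i₀ - a i₀) * p := by linear_combination hint - hi₀
    calc (t' - t) * m = k * u i₀ - (a' i₀ - a i₀) * p := e1
      _ ≡ k * u i₀ - 0 [ZMOD p] := by
          refine Int.ModEq.sub rfl ?_
          exact (Int.modEq_zero_iff_dvd.2 (dvd_mul_left _ _))
      _ = k * u i₀ := sub_zero _
      _ ≡ k * m [ZMOD p] := hu.mul_left k
  have hdvd : (p : ℤ) ∣ (k - (t' - t)) * m := by
    have := (Int.ModEq.dvd hmod)
    -- `p ∣ k m - (t' - t) m`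
    rwa [← sub_mul] at this
  have hprime : Prime (p : ℤ) := Nat.prime_iff_prime_int.1 hp
  rcases hprime.dvd_or_dvd hdvd with hk | hkm
  · -- `p ∣ k - (t' - t)` gives `t' - t ≡ k`, i.e. `k ≡ t' - t`
    exact (Int.modEq_iff_dvd.2 hk).symm
  · exact absurd hkm hm

/-- If `k ≡ 0 (mod p)` and `|k| < p` then `k = 0` (Regev: "`|k| ≥ p` … contradicts the upper
bound", Claims 3.5 / 3.13). [cite: Regev2004, Claim 3.13 (proof, p. 15)] -/
theorem Regev2004.eq_zero_of_modEq_zero_of_abs_lt {p : ℕ} {k : ℤ} (hk : k ≡ 0 [ZMOD p])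
    (hlt : |k| < p) : k = 0 :=
  Int.eq_zero_of_abs_lt_dvd (Int.modEq_zero_iff_dvd.1 hk) hlt

/-- If `k ≡ 1 (mod p)` and `|k| < p - 1` then `k = 1` (Regev: "`k ≡ 1 (mod p)` … this can only
happen when `k = 1`", Claims 3.5 / 3.13). [cite: Regev2004, Claim 3.13 (proof, p. 15)] -/
theorem Regev2004.eq_one_of_modEq_one_of_abs_lt {p : ℕ} {k : ℤ} (hk : k ≡ 1 [ZMOD p])
    (hlt : |k| < p - 1) : k = 1 := by
  have h1 : k - 1 ≡ 0 [ZMOD p] := by simpa using hk.sub_right 1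
  have h2 : |k - 1| < p := by
    have := abs_sub k 1
    rw [abs_one] at this
    linarith
  linarith [Regev2004.eq_zero_of_modEq_zero_of_abs_lt h1 h2]

end ModP

end Literature.Algebra.EuclideanLattices

end
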